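import Summits.HubbardSuperconductivity.HubbardSuperconductivity.Theorems.AnisotropyChordThermalCondensateResponse
import Summits.HubbardSuperconductivity.HubbardSuperconductivity.Theorems.AnisotropyChordThermalChordOfConcave
import Mathlib.Analysis.Calculus.FDeriv.Analytic
import Mathlib.Analysis.Convex.Deriv
import Literature.MathematicalPhysics.QuantumLattice.GibbsLinearResponse
import Mathlib.Analysis.Complex.CauchyIntegral
import Mathlib.Analysis.Analytic.Constructions
import Mathlib.Analysis.Analytic.Linear

/-!
# Route `AnisotropyChord`, crux `ChordXY` (stmt-HubbardSuperconductivity-8146), line `thermal_af`: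
# the canonical sector condensate `Λ_{β,M}(Δ)` is REAL-ANALYTIC in the anisotropy `Δ`

Notation (defs of `…Theorems.AnisotropyChordThermalCondensateDefs`): `P₀ = sectorProj M`,
`A = condensateOp M`, `H_M(Δ) = xxzHamiltonian 1 (torusGraph 2 M) (-1) Δ = H_M(0) + Δ·V`
(`V = H_M(1) - H_M(0)`, `xxzTorus_pencil`), `Λ_{β,M}(Δ) = thermalCondensate M β Δ`.

The line card's transfer claim "`Λ_{β,M}` is analytic in `Δ` at fixed `(β, M)`", typed:

* `differentiable_trace_gibbsWeight_pencil` — for all square matrices `H₀, V, O` the un-normalised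
  expectation `g ↦ tr(e^{-β(H₀+gV)} O)` is complex-differentiable on all of `ℂ` (Kubo–Duhamel,
  `Matrix.hasDerivAt_trace_gibbsWeight_add_smul_mul`, at every base point of the pencil), hence entire
  (`Differentiable.analyticAt`; the same analyticity is the Literature's
  `GibbsAnalyticCoupling.analyticAt_trace_gibbsWeight_mul`, not imported here);
* `analyticAt_sectorTrace`, `analyticAt_sectorPartition` — `Δ ↦ tr(P₀ e^{-βH_M(Δ)} X)` and the sector
  partition function are real-analytic on `ℝ` (restriction of the entire function along `Δ ↦ (Δ : ℂ)`);
* **`analyticAt_thermalCondensate`**, `analyticOnNhd_thermalCondensate` — for even `M ≥ 2` (nonzero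
  sector, `sectorPartition_pos`) the canonical sector condensate `Δ ↦ Λ_{β,M}(Δ)` is real-analytic on
  all of `ℝ` (quotient with non-vanishing denominator, then real part).

* `concaveOn_thermalCondensate_of_deriv2_nonpos`, **`stub_thermalChordAF_of_eventually_deriv2_nonpos`**
  — with analyticity all regularity side conditions of the second-derivative test are discharged, so
  the registered stub `stub_thermalChordAF` follows from EXACTLY the sign statement
  `∀ even M ≥ 4, ∀ᶠ β, ∀ Δ ∈ (-1,0), (d/dΔ)² Λ_{β,M}(Δ) ≤ 0` (the route's "(log Λ_β)'' ≤ …" engine in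
  its weakest usable form).

Consequence for the registered stub `stub_thermalChordAF`: at fixed `(β, M)` the thermal chord is an
inequality between real-analytic functions of `Δ`, so identity-theorem / sign-of-second-derivative
arguments are available (cf. `stub_thermalChordAF_of_eventually_concaveOn`). No crux closes.
Sources: O. Bratteli, D. W. Robinson, *Operator Algebras and Quantum Statistical Mechanics II*
§5.4.1 (analytic perturbation theory of Gibbs states); Dyson–Lieb–Simon (1978) §3. Folklore; no
definition is introduced.
-/

set_option linter.dupNamespace false

noncomputable section

open scoped Matrix.Norms.L2Operator ComplexOrder

namespace Summit.HubbardSuperconductivity.HubbardSuperconductivity.Theorems.AnisotropyChord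

open Matrix Filter Topology
open Literature.MathematicalPhysics.QuantumLattice Literature.Probability.LatticeModels

section Pencil

variable {n : Type*} [Fintype n] [DecidableEq n]

/-- **The un-normalised Gibbs expectation is complex-differentiable in a linear coupling on all of
`ℂ`**: for all square matrices `H₀, V, O` and real `β`, `g ↦ tr(e^{-β(H₀+gV)} O)` is differentiable at
every `g₀ ∈ ℂ` (linear response at the base point `H₀ + g₀V` of the pencil). Bratteli–Robinson II
§5.4.1. [folklore] -/
theorem differentiable_trace_gibbsWeight_pencil (β : ℝ) (H₀ V O : Matrix n n ℂ) :
    Differentiable ℂ (fun g : ℂ => (gibbsWeight β (H₀ + g • V) * O).trace) := by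
  intro g₀
  have h := Matrix.hasDerivAt_trace_gibbsWeight_add_smul_mul β (H₀ + g₀ • V) V O
  have h' : HasDerivAt (fun g : ℂ => (gibbsWeight β (H₀ + g₀ • V + g • V) * O).trace)
      (-(β : ℂ) * ∫ s in (0:ℝ)..1, (O * gibbsWeight (s * β) (H₀ + g₀ • V) * V *
        gibbsWeight ((1 - s) * β) (H₀ + g₀ • V)).trace) (g₀ - g₀) := by
    rw [sub_self]
    exact h
  have hs := h'.comp_sub_const g₀ g₀
  have hfun : (fun g : ℂ => (gibbsWeight β (H₀ + g • V) * O).trace) =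
      fun g : ℂ => (gibbsWeight β (H₀ + g₀ • V + (g - g₀) • V) * O).trace := by
    funext g
    congr 3
    rw [add_assoc, ← add_smul, add_sub_cancel]
  rw [hfun]
  exact hs.differentiableAt

end Pencil

/-- **Sector traces are real-analytic in the anisotropy**: for every `X`,
`Δ ↦ tr(P₀ e^{-βH_M(Δ)} X)` is real-analytic at every `Δ₀` (the entire function of the pencil
`H_M(0) + g·V` restricted to real `g = Δ`, `tr(P₀WX) = tr(W·XP₀)`). [folklore] -/
theorem analyticAt_sectorTrace (M : ℕ) [NeZero M] (β Δ₀ : ℝ)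
    (X : Matrix (TensorIndex (TorusSite 2 M) 2) (TensorIndex (TorusSite 2 M) 2) ℂ) :
    AnalyticAt ℝ (fun Δ : ℝ =>
      (sectorProj M * gibbsWeight β (xxzHamiltonian 1 (torusGraph 2 M) (-1) Δ) * X).trace) Δ₀ := by
  set H0 := xxzHamiltonian 1 (torusGraph 2 M) (-1) 0 with hH0
  set V := xxzHamiltonian 1 (torusGraph 2 M) (-1) 1 - xxzHamiltonian 1 (torusGraph 2 M) (-1) 0
    with hV
  set P := sectorProj M with hP
  have hC : AnalyticAt ℝ (fun g : ℂ => (gibbsWeight β (H0 + g • V) * (X * P)).trace) (Δ₀ : ℂ) :=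
    ((differentiable_trace_gibbsWeight_pencil β H0 V (X * P)).analyticAt (Δ₀ : ℂ)).restrictScalars
  have hR : AnalyticAt ℝ (fun Δ : ℝ => (Δ : ℂ)) Δ₀ := Complex.ofRealCLM.analyticAt Δ₀
  have hcomp := hC.comp hR
  have hfun : (fun Δ : ℝ =>
      (sectorProj M * gibbsWeight β (xxzHamiltonian 1 (torusGraph 2 M) (-1) Δ) * X).trace) =
      (fun g : ℂ => (gibbsWeight β (H0 + g • V) * (X * P)).trace) ∘ fun Δ : ℝ => (Δ : ℂ) := by
    funext Δ
    rw [Function.comp_apply, xxzTorus_pencil M Δ 0, sub_zero, ← hH0, ← hV, ← hP, Matrix.mul_assoc,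
      trace_mul_comm, Matrix.mul_assoc]
  rw [hfun]
  exact hcomp

/-- The sector partition function `Δ ↦ tr(P₀ e^{-βH_M(Δ)})` is real-analytic. [folklore] -/
theorem analyticAt_sectorPartition (M : ℕ) [NeZero M] (β Δ₀ : ℝ) :
    AnalyticAt ℝ (fun Δ : ℝ =>
      (sectorProj M * gibbsWeight β (xxzHamiltonian 1 (torusGraph 2 M) (-1) Δ)).trace) Δ₀ := by
  have h := analyticAt_sectorTrace M β Δ₀ 1
  simp only [Matrix.mul_one] at h
  exact h

/-- **The canonical sector condensate is real-analytic in the anisotropy** (even `M ≥ 2`, every real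
`β`): `Δ ↦ Λ_{β,M}(Δ)` is analytic at every `Δ₀ ∈ ℝ` (analytic numerator and denominator, the
denominator `tr(P₀ e^{-βH_M(Δ₀)}) ≠ 0` by `sectorPartition_pos`, and `Re` is `ℝ`-linear).
Bratteli–Robinson II §5.4.1. [folklore] -/
theorem analyticAt_thermalCondensate (M : ℕ) [NeZero M] (hE : Even M) (h2 : 2 ≤ M) (β Δ₀ : ℝ) :
    AnalyticAt ℝ (fun Δ : ℝ => thermalCondensate M β Δ) Δ₀ := by
  have hN := analyticAt_sectorTrace M β Δ₀ (condensateOp M)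
  have hD := analyticAt_sectorPartition M β Δ₀
  have hD0 : (sectorProj M * gibbsWeight β (xxzHamiltonian 1 (torusGraph 2 M) (-1) Δ₀)).trace ≠ 0 :=
    (sectorPartition_pos M hE h2 β Δ₀).ne'
  have hq := hN.div hD hD0
  have hre := (Complex.reCLM.analyticAt _).comp hq
  have hfun : (fun Δ : ℝ => thermalCondensate M β Δ) =
      (Complex.reCLM : ℂ → ℝ) ∘ ((fun Δ : ℝ =>
        (sectorProj M * gibbsWeight β (xxzHamiltonian 1 (torusGraph 2 M) (-1) Δ) *
            condensateOp M).trace) /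
          fun Δ : ℝ => (sectorProj M * gibbsWeight β (xxzHamiltonian 1 (torusGraph 2 M) (-1) Δ)).trace) := by
    funext Δ
    rw [thermalCondensate_eq, Function.comp_apply, Pi.div_apply, Complex.reCLM_apply]
  rw [hfun]
  exact hre

/-- The canonical sector condensate is real-analytic on all of `ℝ` (even `M ≥ 2`). [folklore] -/
theorem analyticOnNhd_thermalCondensate (M : ℕ) [NeZero M] (hE : Even M) (h2 : 2 ≤ M) (β : ℝ) :
    AnalyticOnNhd ℝ (fun Δ : ℝ => thermalCondensate M β Δ) Set.univ :=
  fun Δ₀ _ => analyticAt_thermalCondensate M hE h2 β Δ₀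

/-! ### The stub from the sign of the second `Δ`-derivative -/

/-- **Second-derivative test, regularity discharged by analyticity**: if at inverse temperature `β`
the second `Δ`-derivative of the canonical sector condensate is `≤ 0` on `(-1,0)`, then
`Δ ↦ Λ_{β,M}(Δ)` is concave on `[-1,0]` (even `M ≥ 2`). [folklore] -/
theorem concaveOn_thermalCondensate_of_deriv2_nonpos (M : ℕ) [NeZero M] (hE : Even M) (h2 : 2 ≤ M)
    (β : ℝ) (h'' : ∀ Δ ∈ Set.Ioo (-1:ℝ) 0, deriv^[2] (fun Δ : ℝ => thermalCondensate M β Δ) Δ ≤ 0) :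
    ConcaveOn ℝ (Set.Icc (-1:ℝ) 0) (fun Δ : ℝ => thermalCondensate M β Δ) := by
  have hA := analyticOnNhd_thermalCondensate M hE h2 β
  refine concaveOn_of_deriv2_nonpos (convex_Icc _ _) (hA.continuousOn.mono (Set.subset_univ _))
    (hA.differentiableOn.mono (Set.subset_univ _))
    (hA.deriv.differentiableOn.mono (Set.subset_univ _)) ?_
  rw [interior_Icc]
  exact h''

/-- **Registered stub `stub_thermalChordAF` (ChordXY skeleton `c9438cf6…`) from the SIGN OF THE SECOND
`Δ`-DERIVATIVE of the canonical sector condensate on `(-1,0)`, eventually in `β`** — the route's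
variance-comparison engine in its weakest usable form; conclusion verbatim the stub's.
(`concaveOn_thermalCondensate_of_deriv2_nonpos` + `stub_thermalChordAF_of_eventually_concaveOn`.)
[folklore] -/
theorem stub_thermalChordAF_of_eventually_deriv2_nonpos
    (hsign : ∀ (M : ℕ) [NeZero M], Even M → 4 ≤ M → ∀ᶠ β : ℝ in atTop,
      ∀ Δ ∈ Set.Ioo (-1:ℝ) 0, deriv^[2] (fun Δ : ℝ => thermalCondensate M β Δ) Δ ≤ 0) :
    ∀ (M : ℕ) [NeZero M], Even M → 4 ≤ M → ∀ Δ ∈ Set.Icc (-1:ℝ) 0,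
      ∀ᶠ β : ℝ in atTop, (1 + Δ) * thermalCondensate M β 0 ≤ thermalCondensate M β Δ :=
  stub_thermalChordAF_of_eventually_concaveOn fun M _ hE h4 =>
    (hsign M hE h4).mono fun β hβ =>
      concaveOn_thermalCondensate_of_deriv2_nonpos M hE (le_trans (by norm_num) h4) β hβ

end Summit.HubbardSuperconductivity.HubbardSuperconductivity.Theorems.AnisotropyChord

end
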